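import Mathlib
import Summits.Ventures.LatticeQCDFlow.Scaling.ImportanceWeights

/-!
# LatticeQCDFlow / Scaling — pseudofermion (joint) models cannot beat the exact-determinant
# marginal in reweighting ESS

HONEST FRAMING: exact (Metropolis-corrected) sampling algorithms for lattice gauge theory;
figures of merit are autocorrelation/cost numbers at stated couplings and volumes; no
continuum-physics claim.

Venture `LatticeQCDFlow` (cell pub-lqcd), topic `Scaling`, item T2-K of HOME/THEORY-2.md §4 (the
provable core of barrier B4 `FermionDeterminantCost`), landed by FANOUT row 31 from
`HOME/THEORY-2-Sketch.lean` v1.4.  With dynamical fermions the target on gauge fields `U` is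
`e^{−S_g(U)} det D(U)`; flow samplers avoid the `O(V³)` determinant by a JOINT model on
`(U, F)` — gauge flow × conditional pseudofermion model (Abbott et al. PRD 106 (2022) 074506)
— whose `U`-marginal target is the exact-determinant law.  Finite spaces (`U`, `F` `Fintype`s):

* `essFrac_le_essFrac_margU` — for any joint target `p(U, F)` and ANY joint model `q(U, F)`,
  `ESS(p, q) ≤ ESS(p_U, q_U)`: the `χ²` divergence (hence `1/ESS`) can only drop under
  marginalisation (Sedrakyan / Cauchy–Schwarz per fibre, `sum_sq_div_margU_le`).
  Pseudofermion stochasticity buys linear cost per density evaluation at the price of ESS —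
  never the reverse.

The general coarse-graining form (any map `π : X → Y`, e.g. the topological charge) is
`Scaling/SectorBudget.lean`.
-/

namespace Summit.Ventures.LatticeQCDFlow.Theory2

open Finset

variable {U F : Type*} [Fintype U] [Fintype F]

/-- `U`-marginal of a joint law on `U × F` (gauge field `U`, pseudofermion noise `F`).
[folklore] -/
noncomputable def margU (r : U × F → ℝ) : U → ℝ := fun u => ∑ f, r (u, f)

/-- Marginalisation preserves total mass. [folklore] -/
theorem sum_margU (r : U × F → ℝ) : ∑ u, margU r u = ∑ z, r z := by
  rw [Fintype.sum_prod_type]; rfl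

/-- Sedrakyan/Cauchy–Schwarz per fibre: `Σ_u p_U(u)²/q_U(u) ≤ Σ_{u,f} p²/q`, i.e. the `χ²`
divergence (hence `1/ESS`) can only DROP under marginalisation. [folklore] -/
theorem sum_sq_div_margU_le (p q : U × F → ℝ) (hq : ∀ z, 0 < q z) :
    ∑ u, margU p u ^ 2 / margU q u ≤ ∑ z, p z ^ 2 / q z := by
  rw [Fintype.sum_prod_type]
  exact sum_le_sum fun u _ => sq_sum_div_le_sum_sq_div _ _ fun f _ => hq (u, f)

/-- **T2-K (FermionDeterminantCost, provable core).**  For a joint target `p(U, F)` whose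
`U`-marginal is the exact-determinant gauge law and ANY joint model `q(U, F)` (marginal gauge
flow × conditional pseudofermion model, Abbott et al. PRD 106 (2022) 074506), the reweighting ESS
of the joint scheme is at most the ESS the gauge marginals alone would have:
`essFrac p q ≤ essFrac p_U q_U`.  Pseudofermion stochasticity buys linear cost per density
evaluation (instead of the `O(V³)` exact determinant) at the price of ESS — never the reverse.
[folklore] -/
theorem essFrac_le_essFrac_margU [Nonempty F] {p q : U × F → ℝ} (hp1 : ∑ z, p z = 1)
    (hq : ∀ z, 0 < q z) (hq1 : ∑ z, q z = 1) :
    essFrac p q ≤ essFrac (margU p) (margU q) := by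
  have hqU : ∀ u, 0 < margU q u := fun u => sum_pos (fun f _ => hq (u, f)) univ_nonempty
  have hpU1 : ∑ u, margU p u = 1 := by rw [sum_margU, hp1]
  have hqU1 : ∑ u, margU q u = 1 := by rw [sum_margU, hq1]
  rw [essFrac_eq_inv hq hp1, essFrac_eq_inv hqU hpU1]
  simp_rw [mul_weight_eq_sq_div]
  have hpos : 0 < ∑ u, margU p u ^ 2 / margU q u := by
    have h := sq_sum_div_le_sum_sq_div univ (margU p) (fun u _ => hqU u)
    rw [hpU1, hqU1] at h
    norm_num at h
    linarith
  exact inv_anti₀ hpos (sum_sq_div_margU_le p q hq)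

end Summit.Ventures.LatticeQCDFlow.Theory2
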